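import Mathlib.Algebra.Group.Subgroup.Map
import Mathlib.Algebra.Group.Subgroup.Lattice
import Mathlib.GroupTheory.GroupAction.ConjAct
import Mathlib.Algebra.BigOperators.Group.Finset.Basic
import Mathlib.Data.Fintype.Basic
import Mathlib.Data.Fintype.Prod
import Mathlib.Data.Finset.Max
import Mathlib.Data.List.GetD
import Mathlib.Tactic.Group
import HarnessLib

/-!
# Certified enumeration of the subgroups of a finite group up to conjugacy

Topic `Literature/GroupTheory`; namespace `Literature.GroupTheory`, grouping namespace
`SubgroupCert`.  A kernel-checkable certificate format for the statement

> every subgroup of the finite group `G` is conjugate to one of the subgroups `K₁, …, K_r`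
> (each given by generators together with its list of elements),

which is how a computer algebra system's table of "conjugacy classes of subgroups" (GAP's
`ConjugacyClassesSubgroups`; Holt–Eick–O'Brien, *Handbook of Computational Group Theory*,
§3.1, §4.5) is consumed by a proof that must quantify over ALL subgroups — here Booker's
dual-monomial positivity `⟨χ, Ind_H^G λ⟩ ≥ 0` "for all monomial `σ`" (Exp. Math. 15 (2006) §2,
the counterexamples `GL₂(𝔽₃)`, `SL₂(𝔽₅)` p. 390), see `Literature/NumberTheory/LFunctions/`.

## The certificate and why it is sound

Group elements are referred to by their index in a list `elems` (checked to exhaust `G`).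
A representative `K` is a `RepData`: generator indices and a BREADTH-FIRST listing of its
elements, each entry `(t, q, s)` recording `elems[t] = (earlier entry q) * (generator s)`, the
first entry being `1`; `carrOK` checks this, so every listed element lies in the subgroup
generated by the generators (`mem_closure_of_carrOK`).  The STEP certificate assigns to every
representative `Kᵢ` and every `g ∉ Kᵢ` a representative `Kⱼ` with MORE listed elements, an
element `y`, and for each generator `s` of `Kⱼ` a word in the letters `Kᵢ ∪ {g}` evaluating to
`y s y⁻¹` (`stepOK`); hence `y Kⱼ y⁻¹ ≤ ⟨Kᵢ, g⟩`.

**Theorem `exists_conj_of_certificate`.**  If some representative is listed as `[1]` and the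
certificate checks, then for every subgroup `H ≤ G` there are a representative `K` and `y ∈ G`
with `H = y K y⁻¹` as sets.  Proof ("grow a subgroup inside `H`"): among the pairs `(i, y)` with
`y Kᵢ y⁻¹ ⊆ H` pick one with `Kᵢ` of maximal listed size; if some `x ∈ H ∖ y Kᵢ y⁻¹` existed,
the step certificate at `(i, y⁻¹ x y)` would produce `(j, y y')` with
`y y' Kⱼ (y y')⁻¹ ⊆ y ⟨Kᵢ, y⁻¹xy⟩ y⁻¹ ⊆ H` and `Kⱼ` larger — contradiction.  No use is made of
the listed element sets being closed under multiplication or duplicate-free.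

Also here: the transport of a sum over `H = y K y⁻¹` to a sum over the listed elements of `K`
(`sum_subgroup_eq_sum_carrier`), used to evaluate `Σ_{h ∈ H} χ(h) λ(h⁻¹)` for class functions `χ`.

## References
* [HoltEickOBrien2005] D. F. Holt, B. Eick, E. A. O'Brien, *Handbook of Computational Group
  Theory*, Chapman & Hall/CRC 2005, §3.1 (subgroup lattices / conjugacy classes of subgroups), §4.5.
* [Booker2006] A. R. Booker, *Artin's conjecture, Turing's method, and the Riemann hypothesis*,
  Experiment. Math. 15 (2006) 385–407, §2 p. 390 ("shown with the aid of … GAP").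
-/

namespace Literature.GroupTheory

namespace SubgroupCert

variable {G : Type} [Group G] [DecidableEq G]

/-! ### Certificate format -/

/-- The `n`-th listed element (`1` if out of range). [folklore] -/
def el (elems : List G) (n : ℕ) : G := elems.getD n 1

/-- A representative subgroup: generator indices and a breadth-first element listing
`(elementIndex, parentPosition, generatorPosition)`. [cite: HoltEickOBrien2005, §3.1] -/
structure RepData where
  /-- indices (into `elems`) of the generators -/
  gens : List ℕ
  /-- the listed elements with their BFS parents -/
  carr : List (ℕ × ℕ × ℕ)
  deriving Inhabited

/-- The generators of a representative, as group elements. [folklore] -/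
def gensList (elems : List G) (R : RepData) : List G := R.gens.map (el elems)

/-- The listed elements of a representative, as group elements. [folklore] -/
def carrierList (elems : List G) (R : RepData) : List G := R.carr.map fun t => el elems t.1

/-- Check of the BFS listing: each entry equals an earlier entry times a generator;
`pref` = the elements already validated. [folklore] -/
def carrOKAux (elems : List G) (gs : List G) : List G → List (ℕ × ℕ × ℕ) → Bool
  | _, [] => true
  | pref, (t, q, s) :: rest =>
      decide (q < pref.length) && decide (el elems t = pref.getD q 1 * gs.getD s 1) &&
        carrOKAux elems gs (pref ++ [el elems t]) rest

/-- Check of a representative: the listing starts with `1` and is a BFS listing. [folklore] -/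
def carrOK (elems : List G) (R : RepData) : Bool :=
  match R.carr with
  | [] => false
  | (t, _, _) :: rest => decide (el elems t = 1) && carrOKAux elems (gensList elems R) [1] rest

/-- Evaluation of a word: letter `none` is the adjoined element `g`, letter `some t` is
`elems[t]`. [folklore] -/
def evalWord (elems : List G) (g : G) : List (Option ℕ) → G
  | [] => 1
  | none :: w => g * evalWord elems g w
  | some t :: w => el elems t * evalWord elems g w

/-- The letters of a word other than `g` are listed elements of `Kᵢ`. [folklore] -/
def lettersOK (elems : List G) (Ki : List G) (w : List (Option ℕ)) : Bool :=
  w.all fun a => match a with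
    | none => true
    | some t => decide (el elems t ∈ Ki)

/-- One step certificate `(j, y, words)`: `Kⱼ` has more listed elements than `Kᵢ` and each
generator `s` of `Kⱼ` satisfies `y s y⁻¹ = word(Kᵢ, g)`; `none` asserts `g ∈ Kᵢ`.
[cite: HoltEickOBrien2005, §4.5] -/
def stepOK (elems : List G) (reps : List RepData) (i : ℕ) (g : G) :
    Option (ℕ × ℕ × List (List (Option ℕ))) → Bool
  | none => decide (g ∈ carrierList elems (reps.getD i default))
  | some (j, yi, ws) =>
      decide ((reps.getD i default).carr.length < (reps.getD j default).carr.length) &&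
      decide ((gensList elems (reps.getD j default)).length = ws.length) &&
      (List.zip (gensList elems (reps.getD j default)) ws).all fun p =>
        lettersOK elems (carrierList elems (reps.getD i default)) p.2 &&
          decide (evalWord elems g p.2 = el elems yi * p.1 * (el elems yi)⁻¹)

/-- Row `i` of the step certificate (aligned with `elems`): a step for every `g ∈ G`.
[cite: HoltEickOBrien2005, §4.5] -/
def rowOK (elems : List G) (reps : List RepData)
    (cert : List (List (Option (ℕ × ℕ × List (List (Option ℕ)))))) (i : ℕ) : Bool :=
  decide (elems.length ≤ (cert.getD i []).length) &&
    (List.zip elems (cert.getD i [])).all fun p => stepOK elems reps i p.1 p.2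

/-- The whole step certificate: all rows check. [cite: HoltEickOBrien2005, §4.5] -/
def certOK (elems : List G) (reps : List RepData)
    (cert : List (List (Option (ℕ × ℕ × List (List (Option ℕ)))))) : Bool :=
  (List.range reps.length).all (rowOK elems reps cert)

omit [DecidableEq G] in
/-- `certOK` from its rows (lets the rows be kernel-checked one at a time).
[cite: HoltEickOBrien2005, §4.5] -/
theorem certOK_of_rowOK [DecidableEq G] (elems : List G) (reps : List RepData)
    (cert : List (List (Option (ℕ × ℕ × List (List (Option ℕ))))))
    (h : ∀ i, i < reps.length → rowOK elems reps cert i = true) : certOK elems reps cert = true := by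
  unfold certOK
  rw [List.all_eq_true]
  intro i hi
  exact h i (List.mem_range.mp hi)

/-! ### Soundness of the element listings -/

/-- If all of `pref` lies in a subgroup `S` containing the generators, so does everything
validated by `carrOKAux`. [folklore] -/
private theorem carrOKAux_sound (elems : List G) (gs : List G) (S : Subgroup G)
    (hgs : ∀ s ∈ gs, s ∈ S) :
    ∀ (rest : List (ℕ × ℕ × ℕ)) (pref : List G), (∀ x ∈ pref, x ∈ S) →
      carrOKAux elems gs pref rest = true → ∀ e ∈ rest, el elems e.1 ∈ S := by
  intro rest
  induction rest with
  | nil => intro _ _ _ e he; simp at he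
  | cons hd rest ih =>
    intro pref hpref hok e he
    obtain ⟨t, q, s⟩ := hd
    simp only [carrOKAux, Bool.and_eq_true, decide_eq_true_eq] at hok
    obtain ⟨⟨hq, heq⟩, hrest⟩ := hok
    have ht : el elems t ∈ S := by
      rw [heq]
      refine S.mul_mem ?_ ?_
      · rw [List.getD_eq_getElem _ _ hq]
        exact hpref _ (List.getElem_mem hq)
      · by_cases hs : s < gs.length
        · rw [List.getD_eq_getElem _ _ hs]; exact hgs _ (List.getElem_mem hs)
        · rw [List.getD_eq_default _ _ (not_lt.mp hs)]; exact S.one_mem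
    rcases List.mem_cons.mp he with rfl | he'
    · exact ht
    · refine ih (pref ++ [el elems t]) ?_ hrest e he'
      intro x hx
      rcases List.mem_append.mp hx with hx | hx
      · exact hpref x hx
      · rw [List.mem_singleton.mp hx]; exact ht

/-- **Listed elements lie in the subgroup generated by the generators** (soundness of the
orbit/closure enumeration). [cite: HoltEickOBrien2005, §3.1] -/
theorem mem_closure_of_carrOK (elems : List G) (R : RepData) (h : carrOK elems R = true)
    {x : G} (hx : x ∈ carrierList elems R) :
    x ∈ Subgroup.closure {s | s ∈ gensList elems R} := by
  set S := Subgroup.closure {s | s ∈ gensList elems R}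
  have hgs : ∀ s ∈ gensList elems R, s ∈ S := fun s hs => Subgroup.subset_closure hs
  unfold carrOK at h
  unfold carrierList at hx
  obtain ⟨e, he, rfl⟩ := List.mem_map.mp hx
  rcases hR : R.carr with _ | ⟨⟨t0, q0, s0⟩, rest⟩
  · rw [hR] at he; simp at he
  · rw [hR] at h he
    simp only [Bool.and_eq_true, decide_eq_true_eq] at h
    obtain ⟨h1, hrest⟩ := h
    rcases List.mem_cons.mp he with rfl | he'
    · show el elems t0 ∈ S
      rw [h1]; exact S.one_mem
    · exact carrOKAux_sound elems _ S hgs rest [1] (by simp [S.one_mem]) hrest e he'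

/-! ### Soundness of words -/

/-- A word in `Kᵢ ∪ {g}` evaluates into any subgroup containing `Kᵢ` and `g`. [folklore] -/
private theorem evalWord_mem (elems : List G) (Ki : List G) (g : G) (S : Subgroup G)
    (hK : ∀ k ∈ Ki, k ∈ S) (hg : g ∈ S) :
    ∀ w : List (Option ℕ), lettersOK elems Ki w = true → evalWord elems g w ∈ S := by
  intro w
  induction w with
  | nil => intro _; exact S.one_mem
  | cons a w ih =>
    intro hw
    cases a with
    | none =>
      simp only [lettersOK, List.all_cons, Bool.true_and] at hw
      exact S.mul_mem hg (ih hw)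
    | some t =>
      simp only [lettersOK, List.all_cons, Bool.and_eq_true, decide_eq_true_eq] at hw
      exact S.mul_mem (hK _ hw.1) (ih hw.2)

/-! ### The covering theorem -/

/-- The subgroup `{z | y z y⁻¹ ∈ H}` (`= y⁻¹ H y`). [folklore] -/
def conjInto (H : Subgroup G) (y : G) : Subgroup G := H.comap (MulAut.conj y).toMonoidHom

omit [DecidableEq G] in
/-- Membership in `conjInto H y`. [folklore] -/
private theorem mem_conjInto {H : Subgroup G} {y z : G} : z ∈ conjInto H y ↔ y * z * y⁻¹ ∈ H := Iff.rfl

/-- From a valid step certificate at `(i, g)` with `g ∉ Kᵢ`: a larger representative is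
conjugate into any subgroup containing `Kᵢ` and `g`. [cite: HoltEickOBrien2005, §4.5] -/
theorem step_sound (elems : List G) (reps : List RepData)
    (hcarr : ∀ R ∈ reps, carrOK elems R = true)
    (i : ℕ) (g : G) (c : Option (ℕ × ℕ × List (List (Option ℕ))))
    (hc : stepOK elems reps i g c = true) (hg : g ∉ carrierList elems (reps.getD i default))
    (S : Subgroup G) (hK : ∀ k ∈ carrierList elems (reps.getD i default), k ∈ S) (hgS : g ∈ S) :
    ∃ j y, (reps.getD i default).carr.length < (reps.getD j default).carr.length ∧
      ∀ k ∈ carrierList elems (reps.getD j default), y * k * y⁻¹ ∈ S := by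
  cases c with
  | none =>
    simp only [stepOK, decide_eq_true_eq] at hc
    exact absurd hc hg
  | some c =>
    obtain ⟨j, yi, ws⟩ := c
    simp only [stepOK, Bool.and_eq_true, decide_eq_true_eq, List.all_eq_true] at hc
    obtain ⟨⟨hlen, hws⟩, hall⟩ := hc
    refine ⟨j, el elems yi, hlen, ?_⟩
    -- the generators of `K_j`, conjugated by `y`, lie in `S`
    have hgen : ∀ s ∈ gensList elems (reps.getD j default),
        el elems yi * s * (el elems yi)⁻¹ ∈ S := by
      intro s hs
      obtain ⟨n, hn, rfl⟩ := List.getElem_of_mem hs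
      have hn' : n < ws.length := hws ▸ hn
      have hzip : n < (List.zip (gensList elems (reps.getD j default)) ws).length := by
        rw [List.length_zip]; exact lt_min hn hn'
      have hp : ((gensList elems (reps.getD j default))[n], ws[n]) ∈
          List.zip (gensList elems (reps.getD j default)) ws := by
        rw [← List.getElem_zip (h := hzip)]
        exact List.getElem_mem hzip
      have h2 := hall _ hp
      rw [← h2.2]
      exact evalWord_mem elems _ g S hK hgS _ h2.1
    -- hence all of `K_j` (which lies in the closure of its generators)
    intro k hk
    by_cases hj : j < reps.length
    · have hR : reps.getD j default ∈ reps := by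
        rw [List.getD_eq_getElem _ _ hj]; exact List.getElem_mem hj
      have hcl := mem_closure_of_carrOK elems _ (hcarr _ hR) hk
      have hle : Subgroup.closure {s | s ∈ gensList elems (reps.getD j default)} ≤
          conjInto S (el elems yi) := by
        rw [Subgroup.closure_le]
        intro s hs
        exact (mem_conjInto).mpr (hgen s hs)
      exact (mem_conjInto).mp (hle hcl)
    · exfalso
      rw [List.getD_eq_default _ _ (not_lt.mp hj)] at hlen
      exact Nat.not_lt_zero _ hlen

variable [Fintype G]

/-- **Every subgroup is conjugate to a listed representative** (as a set of elements), given a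
checked certificate: `elems` exhausts `G`, every representative's listing is a valid BFS
listing, one representative is listed as `[1]`, and the step certificate checks.
[cite: HoltEickOBrien2005, §3.1] -/
theorem exists_conj_of_certificate (elems : List G) (reps : List RepData)
    (cert : List (List (Option (ℕ × ℕ × List (List (Option ℕ))))))
    (helems : ∀ g : G, g ∈ elems) (hcarr : ∀ R ∈ reps, carrOK elems R = true)
    (hbot : ∃ R ∈ reps, carrierList elems R = [1]) (hcert : certOK elems reps cert = true)
    (H : Subgroup G) :
    ∃ R ∈ reps, ∃ y : G, ∀ x : G, x ∈ H ↔ ∃ k ∈ carrierList elems R, y * k * y⁻¹ = x := by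
  classical
  -- admissible pairs `(i, y)` with `y Kᵢ y⁻¹ ⊆ H`
  let adm : Finset (Fin reps.length × G) := Finset.univ.filter fun p =>
    ∀ k ∈ carrierList elems (reps.getD p.1 default), p.2 * k * p.2⁻¹ ∈ H
  obtain ⟨R0, hR0, hR0c⟩ := hbot
  obtain ⟨i0, hi0, hi0e⟩ := List.getElem_of_mem hR0
  have hne : adm.Nonempty := by
    refine ⟨(⟨i0, hi0⟩, 1), Finset.mem_filter.mpr ⟨Finset.mem_univ _, ?_⟩⟩
    intro k hk
    have hget : reps.getD i0 default = R0 := by rw [List.getD_eq_getElem _ _ hi0, hi0e]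
    simp only [hget, hR0c, List.mem_singleton] at hk
    rw [hk]; simp [H.one_mem]
  obtain ⟨⟨i, y⟩, hmem, hmax⟩ :=
    adm.exists_max_image (fun p => (reps.getD p.1 default).carr.length) hne
  have hiy : ∀ k ∈ carrierList elems (reps.getD i default), y * k * y⁻¹ ∈ H :=
    (Finset.mem_filter.mp hmem).2
  have hRi : reps.getD (i : ℕ) default ∈ reps := by
    rw [List.getD_eq_getElem _ _ i.2]; exact List.getElem_mem i.2
  refine ⟨reps.getD i default, hRi, y, fun x => ⟨fun hx => ?_, ?_⟩⟩
  · -- maximality: otherwise the step certificate yields a larger admissible pair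
    by_contra hcon
    push Not at hcon
    set g := y⁻¹ * x * y with hg
    have hgK : g ∉ carrierList elems (reps.getD i default) := by
      intro h
      exact hcon g h (by rw [hg]; group)
    -- locate `g` in `elems` and read off its certificate
    obtain ⟨n, hn, hgn⟩ := List.getElem_of_mem (helems g)
    have hrow := hcert
    simp only [certOK, List.all_eq_true] at hrow
    have hrow' := hrow i (List.mem_range.mpr i.2)
    simp only [rowOK, List.all_eq_true, Bool.and_eq_true, decide_eq_true_eq] at hrow'
    obtain ⟨hlen, hall⟩ := hrow'
    have hn' : n < (cert.getD (i : ℕ) []).length := lt_of_lt_of_le hn hlen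
    have hzip : n < (List.zip elems (cert.getD (i : ℕ) [])).length := by
      rw [List.length_zip]; exact lt_min hn hn'
    have hp : (elems[n], (cert.getD (i : ℕ) [])[n]) ∈ List.zip elems (cert.getD (i : ℕ) []) := by
      rw [← List.getElem_zip (h := hzip)]
      exact List.getElem_mem hzip
    have hstep := hall _ hp
    rw [hgn] at hstep
    -- the subgroup `S = {z | y z y⁻¹ ∈ H}` contains `Kᵢ` and `g`
    have hS : ∀ k ∈ carrierList elems (reps.getD i default), k ∈ conjInto H y :=
      fun k hk => (mem_conjInto).mpr (hiy k hk)
    have hgS : g ∈ conjInto H y := by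
      rw [mem_conjInto, hg]
      have : y * (y⁻¹ * x * y) * y⁻¹ = x := by group
      rw [this]; exact hx
    obtain ⟨j, y', hlt, hj⟩ := step_sound elems reps hcarr i g _ hstep hgK (conjInto H y) hS hgS
    have hjlt : j < reps.length := by
      by_contra hj'
      rw [List.getD_eq_default _ _ (not_lt.mp hj')] at hlt
      exact Nat.not_lt_zero _ hlt
    have hadm : (⟨j, hjlt⟩, y * y') ∈ adm := by
      refine Finset.mem_filter.mpr ⟨Finset.mem_univ _, fun k hk => ?_⟩
      have := (mem_conjInto).mp (hj k hk)
      have e : y * y' * k * (y * y')⁻¹ = y * (y' * k * y'⁻¹) * y⁻¹ := by group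
      rw [e]; exact this
    have := hmax _ hadm
    exact absurd hlt (not_lt.mpr this)
  · rintro ⟨k, hk, rfl⟩
    exact hiy k hk

omit [DecidableEq G] [Fintype G] in
/-- **Transport of a sum over `H = y K y⁻¹` to the listed elements of `K`** (for a listing
without repetitions): `Σ_{h ∈ H} F(h) = Σ_{k ∈ K} F(y k y⁻¹)` (the change of variables
`h = y k y⁻¹` of Serre §7.2). [cite: SerreLinearRepresentations1977, §7.2] -/
theorem sum_subgroup_eq_sum_carrier [DecidableEq G] {M : Type*} [AddCommMonoid M]
    (H : Subgroup G) [Fintype H] (K : List G) (y : G)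
    (hH : ∀ x : G, x ∈ H ↔ ∃ k ∈ K, y * k * y⁻¹ = x) (F : G → M) :
    ∑ h : H, F h = ∑ k ∈ K.toFinset, F (y * k * y⁻¹) := by
  classical
  have hmemH : ∀ k ∈ K.toFinset, y * k * y⁻¹ ∈ H := fun k hk =>
    (hH _).mpr ⟨k, List.mem_toFinset.mp hk, rfl⟩
  refine (Finset.sum_bij' (fun k hk => (⟨y * k * y⁻¹, hmemH k hk⟩ : H))
    (fun h _ => y⁻¹ * (h : G) * y) ?_ ?_ ?_ ?_ ?_).symm
  · intro k _; exact Finset.mem_univ _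
  · intro h _
    obtain ⟨k, hk, hkeq⟩ := (hH h).mp h.2
    rw [List.mem_toFinset, ← hkeq]
    have : y⁻¹ * (y * k * y⁻¹) * y = k := by group
    rw [this]; exact hk
  · intro k _
    show y⁻¹ * (y * k * y⁻¹) * y = k
    group
  · intro h _
    apply Subtype.ext
    show y * (y⁻¹ * (h : G) * y) * y⁻¹ = h
    group
  · intro k _; rfl

end SubgroupCert

end Literature.GroupTheory
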